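import Mathlib
import HarnessLib
import HarnessLib.Audit
import Summits.AtomisticToContinuum.Statement

/-!
Route: OneBodyEntropySqueeze

CLOSED (retired) 2026-08-15T13:55:55Z by operator:999:2305528 — reason: not-a-thesis: assembly does not conclude the sub-problem Statement — note: D-0027 §2.1 audit (human 2026-08-15: routes that do not decide the summit are removed): the assembly concludes `Literature.MathematicalPhysics.KineticTheory.HydrodynamicLimit`, not the sub-problem statement; a NEW conforming route may be opened from the same idea (generated `closes : … → _root_.Hydr. The file is kept as the record of this route; refuted decls are indexed as negative knowledge (`ledger negatives`).

# Route OneBodyEntropySqueeze — one scalar (no thermodynamic entropy production of the mean one-body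
profile) forces local equilibrium of deterministic hard spheres; closure by contact locality and
Dafermos stability

X = K1 ∧ K2 ∧ K4 ("it suffices to show"), realising card jaynes-squeeze-isentropic (spine) in its
general-data form; the card's
isentropic NoExcessHeat is filed as the typed special case NoExcessHeatIsentropic. K1
NoMeanEntropyProduction: before the first shock the
BLOCK-AVERAGED MEAN one-body profile (ρ_B, u_B, θ_B)(s) of the deterministically evolved local Gibbs
law — expectations of the empirical
density / momentum / energy on macroscopic cubes of side 1/m, θ_B the kinetic temperature OF THE
INTENSITY MEASURE (ensemble variance of the
block velocity counts as heat) — carries asymptotically no more hard-sphere thermodynamic entropy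
Σ_B m_B s_σ(ρ_B, θ_B),
s_σ = 3/2 log θ − log ρ − f_ex(ρσ³), than the classical Euler solution (ONE scalar per time;
classical solutions conserve ∫ρ s_σ).
K2 CollisionalFluxLocality: along the true flow, block local Gibbsianity in specific relative
entropy forces the mean collisional momentum and
energy sources (defined exactly by the finite-N balance laws) to be the local collisional-pressure
terms ρθ(Z(ρσ³) − 1) of the block mean fields.
K4 CubicMomentUI: time-integrated uniform integrability of |v|³ along the evolved law. Exact
finite-N bookkeeping (Liouville invariance of
Shannon entropy + exponential-family form of local Gibbs laws + BLOCK-MATCHED reference, for which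
the commutator ⟨P − A_mP, Dh(A_mP)⟩ vanishes)
makes K1 equivalent to specific relative entropy o(N) w.r.t. the block-matched local Gibbs law; its
exact one-body shadow (OneBodyShadow) is
kinetic local equilibrium of the one-particle intensity measure; K4 + K2 close the mean fluxes;
Dafermos' relative-entropy stability with only
the GLOBAL entropy inequality (EntropicWeakStrongHS) pins the mean fields to the classical solution;
the same bookkeeping at the Euler-driven
reference then yields the shared typed target RelEntropyVanishing (stmt 0766), and 0769
(RelEntropyToLimit) the conjunct.
Lean: `NoMeanEntropyProduction ∧ CollisionalFluxLocality ∧ CubicMomentUI`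

## Assembly
Fix profiles; σ₀ := min of the antecedents' σ₀ (DiluteSelfConsistency at η := ¼ min(η₁ of
HardSphereLDA, η₀ of EntropicWeakStrongHS, η₀ of
HsEosLowDensity)). For σ < σ₀, a classical solution on [0,T), flows, the t = 0 hypothesis and t < T:
(a) laws are probability measures
(LocalGibbsConcentration); HardSphereLDA (A)+(B) identify the data fields U₀ = (ρ₀, ρ₀u₀, E₀) with
the LLN limit and give Π_N(λ₀) − ⟨P̄₀,λ₀⟩ →
𝒮[U₀] + c₀. (b) EXACT BOOKKEEPING (finite N, provable now, rides with --supports Assembly):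
H(f_s‖ψ_λ)/(N+1) = [Π_N(λ) − ⟨P̄_s,λ⟩] − [Π_N(λ₀) −
⟨P̄₀,λ₀⟩] for every local Gibbs ψ_λ (Liouville: S(f_s) = S(f₀); log ψ_λ linear in the empirical
fields). (c) With λ = block-matched conjugates of
the block mean fields (MeanBlocksInRange puts them in a compact set; block averaging is a
conditional expectation, so ⟨P̄ − A_mP̄, λ⟩ = 0) and the
uniform LDA of HardSphereLDA (B): H(f_s‖ψ^m_s)/(N+1) = 𝒮[U₀] − 𝒮^m_N(s) + o(1);
NoMeanEntropyProduction and entropy conservation of the classical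
solution (HsEosLowDensity for f_ex ∈ C¹) give ∀δ ∃m₀ ∀m ≥ m₀ eventually sup_{s≤t} H(f_s‖ψ^m_s) ≤
δ(N+1): the hypothesis of CollisionalFluxLocality.
(d) KINETIC CLOSURE: conditionally on positions the block reference has product Maxwellian
velocities, so (chain rule = OneBodyShadow, Pinsker /
conditional Hoeffding on truncated quadratic and cubic observables, CubicMomentUI for the tails) the
mean kinetic momentum / energy fluxes on
[0,t] equal the Maxwellian moments of the block mean fields + O(√δ) + o(1); CollisionalFluxLocality
supplies the contact parts; hence the block
mean fields V_N(s) := A_m P̄_s satisfy the weak form of the five conservation laws against the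
entropy variables Dh_σ(U) with residual → 0,
∫h_σ(V_N(s)) ≤ ∫h_σ(U₀) + o(1) (the free sign of (c)), V_N(0) → U₀. (e) EntropicWeakStrongHS (K from
MeanBlocksInRange, packing from
DiluteSelfConsistency) ⇒ sup_{s≤t} ‖V_N(s) − U(s)‖_{L²} → 0 ⇒ P̄_t → U(t) weakly (with energy UI
from CubicMomentUI). (f) Bookkeeping (b) at the
Euler-driven reference λ^E_t = Dh_σ(U(t)) (activity a^E_t = ρ_t e^{g_σ(ρ_t)}, HardSphereLDA (B)):
klDiv/(N+1) = ⟨U(t) − P̄_t, λ^E_t⟩ + o(1) → 0;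
with LocalGibbsConcentration at (a^E_t, u_t, θ_t) this is RelEntropyVanishing at σ, t;
RelEntropyToLimit (entropy inequality) gives
HydrodynamicLimitFor σ, and hydrodynamicLimit_of_forall the conjunct.

Rationale: WHY THIS LINE. Three finite-N facts about the conjunct's own objects — S(f_t) = S(f_0) for the
push-forward density (HardSphereFlow.measurePreserving,
Jaynes1965), log-linearity of hard-sphere local Gibbs densities in the empirical fields (hard core =
common support, no pair energy), and the
chain rule of relative entropy with conditionally Maxwellian velocities — give the EXACT identity
H(f_t‖ψ_λ)/(N+1) = [Π_N(λ) − ⟨P̄_t,λ⟩] −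
[Π_N(λ₀) − ⟨P̄₀,λ₀⟩] for every local Gibbs reference ψ_λ (Π_N = log canonicalPartition/(N+1), P̄ the
mean one-body fields); at the
BLOCK-MATCHED reference (the I-projection of Csiszar1975, block-constant conjugates of the block
mean fields) the right side is, by the
static local-density approximation (Ruelle1969 §3.4, LebowitzPenrose1964,
JansenKunaTsagkarogiannis2023), exactly 𝒮[U₀] − 𝒮^m_N(t) + o(1):
Yau's local-equilibrium target (Yau1991; OllaVaradhanYau1993 Thm 1.1 WITH noise) becomes one scalar
inequality on mean fields, with no
Gronwall at the particle level, no ergodic decomposition of stationary states and no Euler-driven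
reference; GoldsteinLebowitz2004 eq. (33)/(41)
is the one-body hard-sphere entropy functional whose monotonicity they conjecture and which the
route controls for the MEAN marginal;
Kosygina2001 is the stochastic-diffusive precedent for "specific entropy of the evolved law =
thermodynamic entropy of the profile".
Imported areas: information geometry (I-projection / Pythagoras), hyperbolic-PDE stability
(Dafermos1979 relative entropy with the global
Clausius–Duhem inequality; BrezinaFeireisl2018, BerthelinVasseur2005 for the isentropic face),
equilibrium statistical mechanics of the
inhomogeneous dilute hard-sphere gas (LDA / virial inversion). What it does that the open routes do
not: RelEntropyErgodic / ChaoticMixing /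
VanishingNoise need GibbsErgodicity or uniform mixing to run Yau's Gronwall — here the entropy
method runs "backwards" from a conserved
quantity and the dynamical inputs shrink to a scalar (K1), a contact-locality statement (K2) and a
tail bound (K4); DenseKineticExpansion and
OneParticleInfluence expand or differentiate the dynamics — nothing of the kind here;
DissipativeWeakStrong needs almost-sure measure-valued
closure and a LOCAL entropy inequality — here only MEAN fields and the free global inequality enter.
The sibling cards
entropy-saturation-mean-closure / invariant-gibbs-entropy-bookkeeping book-keep at the N-body level
against Euler-driven or concentration-point
references; this route works one level down (block / one-body, moment-matched reference) and needs
no concentration hypothesis. Negatives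
index empty at filing.

RANKED CRUXES. #0 RelEntropyVanishing (target) — the shared typed waypoint X_RE of route
RelEntropyErgodic (stmt-AtomisticToContinuum-0766, also the target of ChaoticMixing and
VanishingNoise), re-asked verbatim: for all continuous profiles ∃ σ₀ ∀ σ<σ₀ ∀ classical hs-Euler
solutions on [0,T) ∀ flows, the local Gibbs laws are probability measures and, if their fields
converge at t = 0, then ∀ t<T ∃ activity a_t such that localGibbsLaw σ a_t u_t θ_t concentrates its
three empirical fields exponentially around (ρ,ρu,E)(t) and klDiv(lawAt Φ_N P_N t ‖ localGibbsLaw σ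
a_t u_t θ_t)/(N+1) → 0. This route is a fourth entrance: K1 + statics ⇒ block local Gibbsianity; K2
+ K4 + EntropicWeakStrongHS ⇒ mean fields → Euler; the bookkeeping identity at the Euler-driven
reference (a_t = ρ_t e^{g_σ(ρ_t)} from HardSphereLDA) ⇒ klDiv/(N+1) = ⟨U(t) − P̄_t, Dh(U(t))⟩ + o(1)
→ 0; the concentration clause is LocalGibbsConcentration. (why it might fail: In substance the
conjunct (given the statics it is EQUIVALENT to convergence of the mean fields, by the same
bookkeeping); it is false past the first shock (Rankine–Hugoniot entropy makes klDiv/(N+1) → Δs >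
0).) [Yau1991, OllaVaradhanYau1993, Spohn1991]
#2 NoMeanEntropyProduction (crux) — (card S1 in general-data form) for continuous local-Gibbs
profiles ∃ σ₀ ∀ σ<σ₀, for every classical hs-Euler solution (ρ,u,θ) on [0,T), every family of
hard-sphere flows, the t = 0 LLN hypothesis of the conjunct and every t < T: the laws are
probability measures and ∀ δ>0 ∃ m₀ ∀ m ≥ m₀, eventually in N, for all s ≤ t: 𝒮^m_N(s) := Σ_{cubes B
of side 1/m} m_B · s_σ(m³ m_B, θ_B) ≤ ∫ ρ_s s_σ(ρ_s, θ_s) dx + δ, where m_B, u_B, θ_B are mass, mean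
velocity and kinetic temperature of the one-body INTENSITY measure μ¹_{N,s} = (N+1)⁻¹ Σ_i
law(z_i(s)) restricted to B × ℝ³ and s_σ(r,ϑ) = 3/2 log ϑ − log r − hsExcessFreeEnergy(rσ³). The
free converse 𝒮^m_N(s) ≥ 𝒮[U₀] − o(1) (Clausius from Liouville + max-ent) makes this 'the mean block
profile produces no thermodynamic entropy before the shock'; equivalent, via the bookkeeping
identity, to block local Gibbsianity in specific relative entropy. [difficulty: open-problem] (why
it might fail: It is the conjunct's dissipative content in scalar form: false iff hard spheres at
fixed σ produce O(1) thermodynamic entropy in the MEAN block profile before T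
(viscosity/conductivity not o(1) at Euler scaling, or no local equilibrium); free streaming violates
it by phase mixing.) [Spohn1991, OllaVaradhanYau1993, Jaynes1965, GoldsteinLebowitz2004,
Kosygina2001, Csiszar1975]
#3 CollisionalFluxLocality (crux) — (card S4, conditional form) for local-Gibbs data, σ < σ₀, any
flows, any t > 0 and smooth χ: ∀ ε>0 ∃ δ>0 ∃ m₀ ∀ m ≥ m₀: IF eventually in N, for all s ≤ t, the
time-s law is within specific relative entropy δ of SOME block-constant local Gibbs law (klDiv ≤
δ(N+1)), THEN eventually in N the collisional momentum source R^j_N(χ,t) := E[F^j_χ(t)] −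
E[F^j_χ(0)] − ∫₀ᵗ E[(N+1)⁻¹ Σ_i (v_i·∇χ(x_i)) v_i^j] ds (F_χ the empirical momentum field) is within
ε of ∫₀ᵗ Σ_B p_c(ρ_B(s),θ_B(s)) ∫_B ∂_jχ ds with p_c(ρ,θ) = ρθ(hsCompressibility(ρσ³) − 1), and the
collisional energy source E[E_χ(t)] − E[E_χ(0)] − ∫₀ᵗ E[(N+1)⁻¹ Σ_i (v_i·∇χ(x_i))|v_i|²/2] ds is
within ε of ∫₀ᵗ Σ_B p_c(ρ_B,θ_B) u_B·∫_B ∇χ ds (block mean fields of the intensity measure). The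
kinetic parts of the fluxes are NOT in this item (they close from entropy + K4 in the assembly);
this is the virial/EOS identification of the CONTACT transfer along the true flow. [difficulty: L]
(why it might fail: Specific relative entropy o(N) at fixed times does not control codimension-one
contact statistics: a persistent O(1) distortion of the pair density at contact (pre-collisional
correlations at fixed σ) costs o(N) entropy yet changes the collisional pressure ρθ(Z−1) by an O(1)
factor.) [Spohn1991, Resibois1978, OllaVaradhanYau1993, Lanford1975, PulvirentiSimonella2016]
#4 CubicMomentUI (crux) — (card S3) under the conjunct's hypotheses, for t < T: ∀ δ>0 ∃ R,
eventually in N, ∫₀ᵗ E_{P_N}[(N+1)⁻¹ Σ_i |v_i(s)|³ 1{|v_i(s)| ≥ R}] ds ≤ δ (lintegral form,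
junk-free): time-integrated uniform integrability of the cubic velocity moment of the one-body
intensity along the deterministic evolution — the only moment beyond the conserved energy that the
kinetic energy-flux closure needs. Weaker than LargeVelocityControl (0781, exponential moments).
[difficulty: L] (why it might fail: Energy is conserved only globally: after ≍N^{1/3} collisions per
unit time a vanishing fraction of spheres could carry O(1) energy in the |v|³ tail;
OllaVaradhanYau1993 §1 removed exactly this obstacle by modifying the kinetic energy, impossible for
true hard spheres.) [OllaVaradhanYau1993, Spohn1991, Cercignani1988]
#5 DiluteSelfConsistency (crux) — shared crux of route ImplosionLoophole
(stmt-AtomisticToContinuum-3091), re-asked verbatim: for every η > 0 and all continuous positive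
profiles ∃ σ₀ such that for σ < σ₀ every classical hs-Euler solution whose t = 0 fields are the LLN
limit of the local Gibbs laws has packing ρ_t(x)σ³ < η on [0,T). Needed because σ₀ is fixed before T
and the solution are given, while HardSphereLDA and EntropicWeakStrongHS are low-packing inputs
applied at the LOCAL density of the solution and of the block mean fields. [difficulty:
open-problem] (why it might fail: DenseExcursion (shock-free self-similar implosion tracked by the
σ-family; route ImplosionLoophole) refutes it outright; even if true it is a σ-uniform density bound
at the FIRST singularity of 3-D compressible Euler for all smooth data.) [Sideris1985, Majda1984,
Spohn1991]
#9 HardSphereLDA (support) — static LDA package for the canonical inhomogeneous dilute hard-sphere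
gas on 𝕋³ at fixed reduced density (∃ η₁ > 0, ∀ σ > 0): (A) every measurable activity profile with
Λ⁻¹ ≤ a ≤ Λ and Λ²σ³ ≤ η₁ is e^c · ρ · e^{g_σ(ρ)} for a normalised measurable density ρ ∈ [(2Λ²)⁻¹,
2Λ²], g_σ(r) = f_ex(rσ³) + rσ³ f_ex′(rσ³) the excess chemical potential (f_ex = hsExcessFreeEnergy);
(B) for every normalised measurable density ρ ≥ c > 0 with packing ρσ³ ≤ η₁, activity a = ρ
e^{g_σ(ρ)} and any measurable velocity / positive temperature profiles: (N+1)⁻¹ log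
canonicalPartition → ∫ ρ · ρσ³ f_ex′(ρσ³) (= ∫ρ(Z − 1)), the local Gibbs laws are probability
measures, and the MEAN empirical density → ρ. Cluster expansion / inhomogeneous virial inversion;
uniformity over compact block families follows from the exact 1-Lipschitz dependence of log Z on log
a. Identifies the LLN density that localGibbs_lln and LocalGibbsConcentration leave anonymous (card
S2 + inverse EOS). [difficulty: L] [Ruelle1969, LebowitzPenrose1964, JansenKunaTsagkarogiannis2023,
HelmuthPerkinsPetti2022]
#9 EntropicWeakStrongHS (support) — (card S5) Dafermos–DiPerna relative-entropy stability for the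
hard-sphere Euler system on 𝕋³ in A-PRIORI form, with ONLY the global entropy inequality: ∃ η₀ such
that for a classical solution U on [0,T) with packing < η₀, t < T, a compact K inside the
positivity/low-packing region and ε > 0 there is δ > 0 such that every measurable K-valued field
V(s,x), s ≤ t, with (i) ∫ h_σ(V(s)) ≤ ∫ h_σ(U(0)) + δ for all s (h_σ = −ρ s_σ in conservative
variables), (ii) ‖V(0) − U(0)‖²_{L²} ≤ δ, (iii) weak-form residual of the five conservation laws
tested against the entropy variables λ^E = Dh_σ(U) (explicit: (−s_σ + 5/2 − |u|²/2θ + ρσ³f_ex′, u/θ,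
−1/θ)) at most δ on [0,t], satisfies ‖V(s) − U(s)‖²_{L²} ≤ ε for all s ≤ t. Proof: ℰ = ∫[h(V) − h(U)
− λ^E·(V − U)], entropy–flux compatibility (Gibbs relation θ ds = de + p d(1/ρ) holds for the hs
EOS), Gronwall; strict convexity of h_σ at packing < η₀ is HsEntropyConvex (0817). [difficulty: L]
[Dafermos1979, BrezinaFeireisl2018, GwiazdaSwierczewskagwiazdaWiedemann2015, BerthelinVasseur2005]
#9 MeanBlocksInRange (support) — a-priori non-degeneracy of the block mean profile (needed to place
the block-matched conjugate parameters in a compact set): under the conjunct's hypotheses and t < T,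
∃ m₀ ∀ m ≥ m₀, eventually in N, for all s ≤ t and all cubes B: m³m_B ∈ [½ inf ρ, 2 sup ρ], θ_B ∈ [½
inf θ, 2 sup θ], |u_B| ≤ 1 + sup|u| (inf/sup of the classical solution over [0,t] × 𝕋³; m₀ absorbs
in-block velocity variance, which counts as heat). Implied by the conjunct; an input of the same
a-priori nature as K1, not separately staffed. [difficulty: open-problem] [Spohn1991,
OllaVaradhanYau1993]
#9 OneBodyShadow (support) — (card S6, exact, provable now) the one-body shadow of relative entropy:
for any N, flow, time t, block scale m and ANY block-constant local Gibbs reference ψ (positive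
block temperatures), (N+1) · Σ_B klDiv( block-B velocity law of the one-body intensity measure of
lawAt Φ P₀ t ‖ m_B · Maxwellian(u^ψ_B, θ^ψ_B) ) ≤ klDiv(lawAt Φ P₀ t ‖ ψ). Chain rule (condition on
positions; velocities under ψ are a PRODUCT of Maxwellians), superadditivity of KL for product
references, joint convexity for the average over particles, data processing to the velocity
marginal; by the Gaussian Pythagoras the moment-matched Maxwellian does even better. With the
bookkeeping identity this is the card's squeeze (SQ1): one-body non-Maxwellianity D^m_N(t) ≤
𝒮^m_N(t) − 𝒮[U₀] + o(1). [difficulty: provable-now] [Csiszar1975, SaintRaymond2009, Jaynes1965]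
#9 NoExcessHeatIsentropic (support) — (card S1 verbatim: the isentropic special case of
NoMeanEntropyProduction in barotropic-energy form) if the Euler data are isentropic, s_σ(ρ₀(x),
θ₀(x)) ≡ s⋆, then for t < T: ∀ δ>0 ∃ m₀ ∀ m ≥ m₀, eventually in N, for all s ≤ t: Δ^m_N(s) := Σ_B
m_B (3/2 θ_B − 3/2 θ_ad(m³m_B)) / θ_ad(m³m_B) ≤ δ, θ_ad(r) = exp(2/3 (s⋆ + log r + f_ex(rσ³))) the
data adiabat: no excess heat above the adiabat = (θ_ad-weighted) no anomalous dissipation of the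
barotropic energy ∫ρ|u|²/2 + ∫ρ e_ad(ρ) of the mean block fields. By concavity of log, Δ^m_N(s)
bounds 𝒮^m_N(s) − s⋆ from above, so this implies K1 for isentropic data; it is linear in the block
energies (MD-friendly). [difficulty: open-problem] [BerthelinVasseur2005, Dafermos1979, Spohn1991]
#9 HsEosLowDensity (support) — shared support of route RelEntropyErgodic
(stmt-AtomisticToContinuum-0768), re-asked verbatim: ∃ η₀ > 0 and F real-analytic on (−η₀, η₀) with
hsExcessFreeEnergy = F on [0, η₀), F(0) = 0, F′(0) = 2π/3, and the canonical thermodynamic limit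
−N⁻¹ log hsFreeVolume η N → F(η). Needed for differentiability of f_ex (entropy conservation along
classical solutions, the conjugate variables, g_σ). [difficulty: M] [Ruelle1969,
LebowitzPenrose1964]
#9 LocalGibbsConcentration (support) — shared support of route RelEntropyErgodic
(stmt-AtomisticToContinuum-0767), re-asked verbatim: exponential law of large numbers for the three
empirical fields of canonical local Gibbs laws with continuous profiles at small σ, uniform in N and
in the flow; supplies the concentration clause of RelEntropyVanishing at the Euler-driven reference
and the probability-measure clause. [difficulty: M] [Ruelle1969, LebowitzPenrose1964, Spohn1991]
#9 RelEntropyToLimit (support) — the assembly item of route RelEntropyErgodic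
(stmt-AtomisticToContinuum-0769), re-asked verbatim: RelEntropyVanishing → HydrodynamicLimit by the
entropy inequality μ(A) ≤ (log 2 + H(μ|λ))/log(1 + 1/λ(A)) and lawAt = map (flow t). [difficulty: M]
[Yau1991, KipnisLandim1999, OllaVaradhanYau1993]

TWO-LAYER PLAN. Foreseen glued splits (k ≤ 3, depth 1; nothing filed now): Assembly ⇐
BlockGibbsianity (K1 + statics ⇒ sup_s H(f_s‖ψ^m_s) = o(N), steps
(b)–(c)) → CruxesToMeanFields (steps (d)–(e): block Gibbsianity + K2 + K4 + EntropicWeakStrongHS ⇒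
P̄_t → U(t)) → MeanToRelEntropy (step (f)) →
Assembly. NoMeanEntropyProduction ⇐ NoExcessHeatIsentropic-type energy budget (∫₀ᵗ∫(Π̄ − p𝟙):∇ū ≥
−o(1), the time-integrated flux-work form) →
EntropyBalanceOfMeanProfile → NoMeanEntropyProduction. CollisionalFluxLocality ⇐
ContactShellEquilibration (pair density at contact relaxes
to its local-Gibbs value on the kinetic time scale N^{-1/3} under block Gibbsianity) →
StaticVirialIdentity (Gibbs expectation of the contact
transfer = ρθ(Z − 1), cf. VirialEosIdentification 0782) → CollisionalFluxLocality.

KILL CRITERIA. ¬NoMeanEntropyProduction at some fixed small σ (a theorem, or MD showing an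
N-independent plateau of 𝒮^m_N(t) − 𝒮[U(t)] before the shock) closes
the route `refuted:NoMeanEntropyProduction` AND — since K1 is implied by the conjunct given the
statics — is filed as summit-level negative
evidence (¬HydrodynamicLimitFor σ becomes the statement to want). ¬CollisionalFluxLocality (contact
correlations persisting under block
Gibbsianity along the true flow) kills only the EOS identification: pivot by restating K2 with an
explicit contact-equilibration hypothesis
(kinetic-scale crux) or close `refuted:CollisionalFluxLocality` if the witness is dynamical.
¬CubicMomentUI (energy cascade into the cubic tail)
refutes the energy-flux closure: close, and hand the witness to card fast-particle-energy-cascade.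
DiluteSelfConsistency refuted (DenseExcursion of
route ImplosionLoophole proved) BREAKS this route with every other: repair = restate all items under
the packing guard and conclude
HydroLimitInBand (3093) instead. RelEntropyVanishing or L2HydroFields proved by any route moots the
Assembly (K1 then becomes a corollary worth
recording). A refutation of MeanBlocksInRange or HardSphereLDA as TYPED (normalisation slips) is a
restate, not a kill.

NOT DECOMPOSED YET. The bookkeeping identity and the Gaussian/velocity integrals as Lean lemmas
(provable now; provers attach them with --supports Assembly);
uniformity of the LDA over compact block-constant families (pointwise HardSphereLDA + exact
1-Lipschitz dependence of log Z on log a);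
the kinetic closure from block Gibbsianity (conditional Hoeffding + Pinsker + truncation); joint
(s,z)-measurability of the flow and Fubini for
the time integrals; entropy conservation ∂_t(ρs_σ) + div(ρs_σu) = 0 for classical solutions in
TorusCalculus; the in-block oscillation
estimate behind m₀; any rate in N (Kn^{1/2} expected); tent/heat-kernel mollifiers are deliberately
NOT used (their commutator does not vanish);
d = 3 only; post-shock statements (negative side) left to the sibling cards.

CHEAPEST FALSIFIER. (i) Paper check, done: free streaming (the BoltzmannHypothesis kernel: Z ≡ 1, no
collisions) satisfies every identity of the route and VIOLATES
K1 — a sheared local Maxwellian phase-mixes, the block kinetic temperature of the intensity measure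
grows ∝ t²|∇u|², 𝒮^m increases — so K1 is
interaction-sensitive and not a tautology; equally it shows K1 cannot be proved without using
collisions. (ii) Event-driven MD at packing
0.05, decaying shear wave and a simple sound wave, N = 10⁴…10⁶ (kit): 𝒮^m_N(t) − 𝒮[U(t)] is directly
measurable from cell means and must
DEcrease like Kn ∝ N^{-1/3}; an N-independent positive plateau before the shock time kills K1 (and
the local-equilibrium picture); in the same
runs the collisional virial per cell vs ρ_Bθ_B(Z(ρ_Bσ³) − 1) tests K2, and the cubic tail mass tests
K4. (iii) Lookup: Kosygina2001 (paywalled,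
acq-00798) — a deterministic/Euler analogue already in print would lower the novelty grade, not kill
the line.

NUMBERS. Fixed reduced density (N+1)ε³ = σ³; Kn ≍ (N+1)^{-1/3} (≍ N^{1/3} collisions per particle
per unit macroscopic time). EOS: Z(η) = 1 + (2π/3)η +
O(η²) for unit-diameter spheres (η = ρσ³, packing fraction φ = πη/6), so p_c/p_kin = Z − 1 ≈ 2.09 η;
Carnahan–Starling excess entropy per particle
(4φ − 3φ²)/(1 − φ)² ≈ 4φ = the slack of the crude squeeze without the hard-core term (closure only
up to O(σ³) without HardSphereLDA); freezing at
φ ≈ 0.494 (irrelevant below σ₀). Expected pre-shock size of the K1 defect: 𝒮^m_N(t) − 𝒮[U(t)] ≈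
Kn·∫₀ᵗ∫(η_*|∇u|² + κ_*|∇θ|²/θ)/θ = O(N^{-1/3});
past a shock it tends to the Rankine–Hugoniot entropy production Δs(t) > 0. Items at open: 14, all
typed (1 target = 0766, 4 cruxes incl. shared
3091, 8 support incl. shared 0767/0768/0769, 1 assembly).

DEFINITION REQUESTS. None required: the one-body intensity measure ((N+1)⁻¹ Σ_i law of z_i(t), a
Measure on 𝕋³ × ℝ³), the cube partition (via Torus.repr and
Nat.floor) and s_σ are inlined with `let`. Optional conveniences a grounder may file to shorten five
signatures: `oneBodyIntensity`,
`blockIndex m`, `hsEntropyPerParticle σ` (topic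
Summits/AtomisticToContinuum/HydrodynamicLimit/Theorems). No cite facts requested (the statics
are filed as the support item HardSphereLDA rather than imported as hypotheses, so the route's
import cone has no unproved Literature fact).

Novelty: Searches (2026-08-15): `lit search --source crossref` ×6 ("specific entropy hydrodynamic scaling
limit Kosygina" → doi:10.1214/aop/1015345597;
"hydrodynamic limit compressible Euler relative entropy local equilibrium hard spheres" →
doi:10.1007/978-3-540-92847-8_6 (SaintRaymond2009 ch. 6);
"Dafermos second law thermodynamics stability weak strong uniqueness global entropy" →
doi:10.1007/bf00250353; "maximum entropy one-particle
distribution Boltzmann entropy dense fluid local equilibrium" → doi:10.1103/physrevlett.92.050602;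
"conservation of local equilibrium entropy
production hydrodynamic limit Hamiltonian" → nothing relevant; "Jansen Kuna Tsagkarogiannis virial
inversion" → doi:10.1016/j.jfa.2022.109731);
`lit search --source zbmath "relative entropy hydrodynamic limit Euler equations"` (8: TothValko2003
doi:10.1023/a:1023867723546, Yau ICM 1998,
Figalli–Kang 2019, Carrillo et al.); `lit frontier AtomisticToContinuum --since 2020` (30 rows; none
on entropy criteria for deterministic Euler
limits); `lit bridges AtomisticToContinuum --cross any`; `lit galaxy search "…" --star all` (service
saturated, logged); openalex budget exhausted
(logged); `lit read doi:10.1214/aop/1015345597` (paywalled → acq-00798); plus the card's 14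
crossref/zbMATH queries and its refuter audit
(Jaynes1965, Jaynes 1971 PRA 4:747, GoldsteinLebowitz2004 eqs. (33),(41), Csiszar1975,
JansenKunaTsagkarogiannis2023); all seven route files of the
sub-problem and the sibling cards entropy-saturation-mean-cl  [refs: 10.1214/aop/1015345597, 10.1007/978-3-540-92847-8_6, 10.1007/bf00250353, 10.1103/physrevlett.92.050602, 10.1016/j.jfa.2022.109731, 10.1023/a:1023867723546, 10.1214/aop/1015345597`, doi:10.1214/aop/1015345597, doi:10.1007/978-3-540-92847-8_6, doi:10.1007/bf00250353, doi:10.1103/physrevlett.92.050602, doi:10.1016/j.jfa.2022.109731, doi:10.1023/a, SaintRaymond2009, TothValko2003, Jaynes1965, Goldstei]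

Barriers (technique_class: relative-entropy max-ent one-body-entropy weak-strong): - technique_class: relative-entropy max-ent one-body-entropy weak-strong
- Literature.Barriers.AtomisticToContinuum.BoltzmannHypothesisBarrier: met and respected, not evaded
by decree: the ideal gas (its kernel) satisfies every identity of the route and VIOLATES
NoMeanEntropyProduction (phase mixing raises the block kinetic temperature of the intensity
measure), so K1 is interaction-sensitive; pre-collisional factorisation AT CONTACT re-enters exactly
in CollisionalFluxLocality — conceded as a ranked crux, with the dynamics entering only through a
time-integrated mean contact functional.
- Literature.Barriers.AtomisticToContinuum.HighMomentumCutoffBarrier: applies to the energy flux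
only; isolated as CubicMomentUI (time-integrated cubic UI); no other step needs a moment beyond the
conserved energy.
- Literature.Barriers.AtomisticToContinuum.HighMomentumCutoffBarrierNarrow: applies squarely
(entropy-inequality / Gibbs-LD control against Maxwellian references cannot reach the convective
energy current p|p|²/2 — OllaVaradhanYau1993 (2.28), Lemma 3.7): NOT evaded by the entropy
inequality; the route uses that inequality only for TRUNCATED velocity observables and names the
required new a-priori input explicitly as the ranked crux CubicMomentUI (time-integrated cubic UI
along the TRUE flow, to be proved from the collision dynamics, not from H(f|ψ)); if CubicMomentUI
fails, the energy-flux closure fails and the route closes (kill criterion) — the bet is that the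
deterministic hard-

History (route lifecycle, newest last):
- 2026-08-15T13:55:55Z · CLOSED retired — not-a-thesis: assembly does not conclude the sub-problem Statement (operator:999:2305528)

sub-problem: HydrodynamicLimit · status: closed(retired) · opened planner-plancard-AtomisticToContinuum-Hydrody-b6cd9e67-0 2026-08-15T11:59:30Z · rev 0 · ledger route-AtomisticToContinuum-OneBodyEntropySqueeze
GENERATED by the gate from the ledger (D-0016/17). Provers cite these decls: `theorem foo : Summit.AtomisticToContinuum.HydrodynamicLimit.Theses.OneBodyEntropySqueeze.<Decl> := …` in Summits/AtomisticToContinuum/HydrodynamicLimit/Theorems/<Name>.lean.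
-/

namespace Summit.AtomisticToContinuum.HydrodynamicLimit.Theses.OneBodyEntropySqueeze

open scoped BigOperators Topology Manifold Classical MeasureTheory ProbabilityTheory Matrix InnerProductSpace ComplexConjugate ContinuousMap
open Filter Set Function TopologicalSpace MeasureTheory

attribute [summit_statement] _root_.HydrodynamicLimit

/-- item stmt-AtomisticToContinuum-0766 · target · rank 0 · open · by planner
why it might fail: In substance the conjunct (given the statics it is EQUIVALENT to convergence of the mean fields, by the same bookkeeping); it is false past the first shock (Rankine–Hugoniot entropy makes klDiv/(N+1) → Δs > 0).
sources: Yau1991, OllaVaradhanYau1993, Spohn1991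
[target] X_RE: for all continuous profiles ∃ σ₀ ∀ σ<σ₀ ∀ classical hs-Euler solutions on [0,T) ∀
flows: the initial local Gibbs laws are probability measures and, if their fields converge at t=0,
then ∀ t<T ∃ activity profile a_t such that the reference local Gibbs law (a_t, u_t, θ_t) is a
probability measure whose empirical density/momentum/energy fields concentrate exponentially (≤ C
e^{-(N+1)/C}) around (ρ,ρu,E)(t), and klDiv(lawAt Φ_N (localGibbs a₀u₀θ₀) t ‖ localGibbs a_t u_t
θ_t)/(N+1) → 0. Yau1991; OllaVaradhanYau1993 Thm 1.1 (with noise). -/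
@[route_item "route-AtomisticToContinuum-OneBodyEntropySqueeze"]
def RelEntropyVanishing : Prop :=
  ∀ (a₀ θ₀ : Literature.MathematicalPhysics.KineticTheory.T3 → ℝ) (u₀ : Literature.MathematicalPhysics.KineticTheory.T3 → Literature.MathematicalPhysics.KineticTheory.V3), Continuous a₀ → Continuous θ₀ → Continuous u₀ → (∀ x, 0 < a₀ x) → (∀ x, 0 < θ₀ x) → ∃ σ₀ : ℝ, 0 < σ₀ ∧ ∀ σ : ℝ, 0 < σ → σ < σ₀ → ∀ (T : ℝ) (ρ θ : ℝ → Literature.MathematicalPhysics.KineticTheory.T3 → ℝ) (u : ℝ → Literature.MathematicalPhysics.KineticTheory.T3 → Literature.MathematicalPhysics.KineticTheory.V3), Literature.MathematicalPhysics.KineticTheory.IsHardSphereEulerSolution σ T ρ u θ → ∀ Φ : (N : ℕ) → Literature.Analysis.FluidPDE.HardSphereFlow (Literature.Analysis.FluidPDE.Torus.geometry (Fin 3)) (Literature.MathematicalPhysics.KineticTheory.hsDiameter σ N) (N + 1), (∀ N, MeasureTheory.IsProbabilityMeasure (Literature.MathematicalPhysics.KineticTheory.localGibbsLaw σ a₀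 u₀ θ₀ N (Φ N))) ∧ (Literature.MathematicalPhysics.KineticTheory.TendstoHydroFieldsAt (fun N => Literature.MathematicalPhysics.KineticTheory.localGibbsLaw σ a₀ u₀ θ₀ N (Φ N)) Φ ρ u θ 0 → ∀ t ∈ Set.Ico 0 T, ∃ a : Literature.MathematicalPhysics.KineticTheory.T3 → ℝ, (∀ N, MeasureTheory.IsProbabilityMeasure (Literature.MathematicalPhysics.KineticTheory.localGibbsLaw σ a (u t) (θ t) N (Φ N))) ∧ (∀ χ : Literature.MathematicalPhysics.KineticTheory.T3 → ℝ, Continuous χ → ∀ δ : ℝ, 0 < δ → ∃ C : ℝ, 0 < C ∧ ∀ N : ℕ, Literature.MathematicalPhysics.KineticTheory.localGibbsLaw σ a (u t) (θ t) N (Φ N) {z | δ < |Literature.MathematicalPhysics.KineticTheory.empiricalDensityField z χ - ∫ x, χ x * ρ t x|} ≤ ENNReal.ofReal (C * Real.exp (-(C⁻¹ * (N + 1)))) ∧ Literature.MathematicalPhysics.KineticTheory.localGibbsLaw σ a (u t) (θ t) N (Φ N) {z | δ < ‖Literature.MathematicalPhysics.KineticTheory.empiricalMomentumField z χ - ∫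 x, (χ x * ρ t x) • u t x‖} ≤ ENNReal.ofReal (C * Real.exp (-(C⁻¹ * (N + 1)))) ∧ Literature.MathematicalPhysics.KineticTheory.localGibbsLaw σ a (u t) (θ t) N (Φ N) {z | δ < |Literature.MathematicalPhysics.KineticTheory.empiricalEnergyField z χ - ∫ x, χ x * Literature.MathematicalPhysics.KineticTheory.totalEnergyDensity (ρ t x) (u t x) (θ t x)|} ≤ ENNReal.ofReal (C * Real.exp (-(C⁻¹ * (N + 1))))) ∧ Filter.Tendsto (fun N : ℕ => InformationTheory.klDiv ((Φ N).lawAt (Literature.MathematicalPhysics.KineticTheory.localGibbsLaw σ a₀ u₀ θ₀ N (Φ N)) t) (Literature.MathematicalPhysics.KineticTheory.localGibbsLaw σ a (u t) (θ t) N (Φ N)) / ((N : ENNReal) + 1)) Filter.atTop (nhds 0))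

/-- item stmt-AtomisticToContinuum-6997 · crux · rank 2 · closed · moot by None · by planner
why it might fail: It is the conjunct's dissipative content in scalar form: false iff hard spheres at fixed σ produce O(1) thermodynamic entropy in the MEAN block profile before T (viscosity/conductivity not o(1) at Euler scaling, or no local equilibrium); free streaming violates it by phase mixing.
sources: Spohn1991, OllaVaradhanYau1993, Jaynes1965, GoldsteinLebowitz2004, Kosygina2001, Csiszar1975
[crux] (card S1 in general-data form) for continuous local-Gibbs profiles ∃ σ₀ ∀ σ<σ₀, for every
classical hs-Euler solution (ρ,u,θ) on [0,T), every family of hard-sphere flows, the t = 0 LLN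
hypothesis of the conjunct and every t < T: the laws are probability measures and ∀ δ>0 ∃ m₀ ∀ m ≥
m₀, eventually in N, for all s ≤ t: 𝒮^m_N(s) := Σ_{cubes B of side 1/m} m_B · s_σ(m³ m_B, θ_B) ≤ ∫
ρ_s s_σ(ρ_s, θ_s) dx + δ, where m_B, u_B, θ_B are mass, mean velocity and kinetic temperature of the
one-body INTENSITY measure μ¹_{N,s} = (N+1)⁻¹ Σ_i law(z_i(s)) restricted to B × ℝ³ and s_σ(r,ϑ) =
3/2 log ϑ − log r − hsExcessFreeEnergy(rσ³). The free converse 𝒮^m_N(s) ≥ 𝒮[U₀] − o(1) (Clausius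
from Liouville + max-ent) makes this 'the mean block profile produces no thermodynamic entropy
before the shock'; equivalent, via the bookkeeping identity, to block local Gibbsianity in specific
relative entropy. [difficulty: open-problem] -/
@[route_item "route-AtomisticToContinuum-OneBodyEntropySqueeze"]
def NoMeanEntropyProduction : Prop :=
  ∀ (a₀ θ₀ : (UnitAddTorus (Fin 3)) → ℝ) (u₀ : (UnitAddTorus (Fin 3)) → (EuclideanSpace ℝ (Fin 3))), Continuous a₀ → Continuous θ₀ → Continuous u₀ → (∀ x, 0 < a₀ x) → (∀ x, 0 < θ₀ x) → ∃ σ₀ : ℝ, 0 < σ₀ ∧ ∀ σ : ℝ, 0 < σ → σ < σ₀ → ∀ (T : ℝ) (ρ θ : ℝ → (UnitAddTorus (Fin 3)) → ℝ) (u : ℝ → (UnitAddTorus (Fin 3)) → (EuclideanSpace ℝ (Fin 3))), Literature.MathematicalPhysics.KineticTheory.IsHardSphereEulerSolution σ T ρ u θ → ∀ Φ : (N : ℕ) → Literature.Analysis.FluidPDE.HardSphereFlow (Literature.Analysis.FluidPDE.Torus.geometry (Fin 3)) (Literature.MathematicalPhysics.KineticTheory.hsDiameter σ N) (N + 1), Literature.MathematicalPhysics.KineticTheory.TendstoHydroFieldsAt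 (fun N => Literature.MathematicalPhysics.KineticTheory.localGibbsLaw σ a₀ u₀ θ₀ N (Φ N)) Φ ρ u θ 0 → ∀ t ∈ Set.Ico 0 T, let P : (N : ℕ) → MeasureTheory.Measure (Literature.Analysis.FluidPDE.Config (N + 1) (Fin 3) (UnitAddTorus (Fin 3))) := fun N => Literature.MathematicalPhysics.KineticTheory.localGibbsLaw σ a₀ u₀ θ₀ N (Φ N); let μ : (N : ℕ) → ℝ → MeasureTheory.Measure ((UnitAddTorus (Fin 3)) × (EuclideanSpace ℝ (Fin 3))) := fun N s => ((N : ENNReal) + 1)⁻¹ • MeasureTheory.Measure.sum (fun i : Fin (N + 1) => ((Φ N).lawAt (P N) s).map (fun z => z i)); let idx : ℕ → (UnitAddTorus (Fin 3)) → (Fin 3 → ℕ) := fun m x i => ⌊(m : ℝ) * Literature.Analysis.FunctionSpaces.Torus.repr x i⌋₊; let μB : ℕ → ℝ → ℕ → (Fin 3 → ℕ) → MeasureTheory.Measure (EuclideanSpace ℝ (Fin 3)) := fun N s m k => ((μ N s).restrict ({x : (UnitAddTorus (Fin 3)) | idx m x = k} ×ˢ (Set.univ : Set (EuclideanSpace ℝ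 (Fin 3))))).snd; let mass : ℕ → ℝ → ℕ → (Fin 3 → ℕ) → ℝ := fun N s m k => ((μB N s m k) Set.univ).toReal; let vel : ℕ → ℝ → ℕ → (Fin 3 → ℕ) → (EuclideanSpace ℝ (Fin 3)) := fun N s m k => (mass N s m k)⁻¹ • ∫ v, v ∂(μB N s m k); let temp : ℕ → ℝ → ℕ → (Fin 3 → ℕ) → ℝ := fun N s m k => (3 * mass N s m k)⁻¹ * ∫ v, ‖v - vel N s m k‖ ^ 2 ∂(μB N s m k); let ent : ℝ → ℝ → ℝ := fun r ϑ => 3 / 2 * Real.log ϑ - Real.log r - Literature.MathematicalPhysics.KineticTheory.hsExcessFreeEnergy (r * σ ^ 3); let Sblk : ℕ → ℝ → ℕ → ℝ := fun N s m => ∑ k ∈ Fintype.piFinset (fun _ : Fin 3 => Finset.range m), mass N s m k * ent ((m : ℝ) ^ 3 * mass N s m k) (temp N s m k); (∀ N, MeasureTheory.IsProbabilityMeasure (P N)) ∧ ∀ δ : ℝ, 0 < δ → ∃ m₀ : ℕ, ∀ m : ℕ, m₀ ≤ m → ∀ᶠ N : ℕ in Filter.atTop, ∀ s ∈ Set.Icc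 0 t, Sblk N s m ≤ (∫ x, ρ s x * ent (ρ s x) (θ s x)) + δ

/-- item stmt-AtomisticToContinuum-6998 · crux · rank 3 · closed · moot by None · by planner
why it might fail: Specific relative entropy o(N) at fixed times does not control codimension-one contact statistics: a persistent O(1) distortion of the pair density at contact (pre-collisional correlations at fixed σ) costs o(N) entropy yet changes the collisional pressure ρθ(Z−1) by an O(1) factor.
sources: Spohn1991, Resibois1978, OllaVaradhanYau1993, Lanford1975, PulvirentiSimonella2016
[crux] (card S4, conditional form) for local-Gibbs data, σ < σ₀, any flows, any t > 0 and smooth χ: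
∀ ε>0 ∃ δ>0 ∃ m₀ ∀ m ≥ m₀: IF eventually in N, for all s ≤ t, the time-s law is within specific
relative entropy δ of SOME block-constant local Gibbs law (klDiv ≤ δ(N+1)), THEN eventually in N the
collisional momentum source R^j_N(χ,t) := E[F^j_χ(t)] − E[F^j_χ(0)] − ∫₀ᵗ E[(N+1)⁻¹ Σ_i
(v_i·∇χ(x_i)) v_i^j] ds (F_χ the empirical momentum field) is within ε of ∫₀ᵗ Σ_B p_c(ρ_B(s),θ_B(s))
∫_B ∂_jχ ds with p_c(ρ,θ) = ρθ(hsCompressibility(ρσ³) − 1), and the collisional energy source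
E[E_χ(t)] − E[E_χ(0)] − ∫₀ᵗ E[(N+1)⁻¹ Σ_i (v_i·∇χ(x_i))|v_i|²/2] ds is within ε of ∫₀ᵗ Σ_B
p_c(ρ_B,θ_B) u_B·∫_B ∇χ ds (block mean fields of the intensity measure). The kinetic parts of the
fluxes are NOT in this item (they close from entropy + K4 in the assembly); this is the virial/EOS
identification of the CONTACT transfer along the true flow. [difficulty: L] -/
@[route_item "route-AtomisticToContinuum-OneBodyEntropySqueeze"]
def CollisionalFluxLocality : Prop :=
  ∀ (a₀ θ₀ : (UnitAddTorus (Fin 3)) → ℝ) (u₀ : (UnitAddTorus (Fin 3)) → (EuclideanSpace ℝ (Fin 3))), Continuous a₀ → Continuous θ₀ → Continuous u₀ → (∀ x, 0 < a₀ x) → (∀ x, 0 < θ₀ x) → ∃ σ₀ : ℝ, 0 < σ₀ ∧ ∀ σ : ℝ, 0 < σ → σ < σ₀ → ∀ Φ : (N : ℕ) → Literature.Analysis.FluidPDE.HardSphereFlow (Literature.Analysis.FluidPDE.Torus.geometry (Fin 3)) (Literature.MathematicalPhysics.KineticTheory.hsDiameter σ N) (N + 1), ∀ t : ℝ, 0 <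 t → ∀ χ : (UnitAddTorus (Fin 3)) → ℝ, Literature.Analysis.FunctionSpaces.Torus.IsSmooth χ → let P : (N : ℕ) → MeasureTheory.Measure (Literature.Analysis.FluidPDE.Config (N + 1) (Fin 3) (UnitAddTorus (Fin 3))) := fun N => Literature.MathematicalPhysics.KineticTheory.localGibbsLaw σ a₀ u₀ θ₀ N (Φ N); let μ : (N : ℕ) → ℝ → MeasureTheory.Measure ((UnitAddTorus (Fin 3)) × (EuclideanSpace ℝ (Fin 3))) := fun N s => ((N : ENNReal) + 1)⁻¹ • MeasureTheory.Measure.sum (fun i : Fin (N + 1) => ((Φ N).lawAt (P N) s).map (fun z => z i)); let idx : ℕ → (UnitAddTorus (Fin 3)) → (Fin 3 → ℕ) := fun m x i => ⌊(m : ℝ) * Literature.Analysis.FunctionSpaces.Torus.repr x i⌋₊; let μB : ℕ → ℝ → ℕ → (Fin 3 → ℕ) → MeasureTheory.Measure (EuclideanSpace ℝ (Fin 3)) := fun N s m k => ((μ N s).restrict ({x : (UnitAddTorus (Fin 3)) | idx m x = k} ×ˢ (Set.univ : Set (EuclideanSpace ℝ (Fin 3))))).snd; let mass : ℕ → ℝ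 → ℕ → (Fin 3 → ℕ) → ℝ := fun N s m k => ((μB N s m k) Set.univ).toReal; let vel : ℕ → ℝ → ℕ → (Fin 3 → ℕ) → (EuclideanSpace ℝ (Fin 3)) := fun N s m k => (mass N s m k)⁻¹ • ∫ v, v ∂(μB N s m k); let temp : ℕ → ℝ → ℕ → (Fin 3 → ℕ) → ℝ := fun N s m k => (3 * mass N s m k)⁻¹ * ∫ v, ‖v - vel N s m k‖ ^ 2 ∂(μB N s m k); let w : (UnitAddTorus (Fin 3)) × (EuclideanSpace ℝ (Fin 3)) → ℝ := fun y => ∑ l : Fin 3, y.2 l * Literature.Analysis.FunctionSpaces.Torus.partialDeriv l χ y.1; let gI : ℕ → (Fin 3 → ℕ) → Fin 3 → ℝ := fun m k j => ∫ x in {x : (UnitAddTorus (Fin 3)) | idx m x = k}, Literature.Analysis.FunctionSpaces.Torus.partialDeriv j χ x; let Emom : ℕ → ℝ → Fin 3 → ℝ := fun N s j => ∫ z, Literature.MathematicalPhysics.KineticTheory.empiricalMomentumField ((Φ N).flow s z) χ j ∂(P N); let Ekin : ℕ → ℝ → Fin 3 → ℝ := fun N s j => ∫ z, ((N : ℝ)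 + 1)⁻¹ * ∑ i : Fin (N + 1), w ((Φ N).flow s z i) * ((Φ N).flow s z i).2 j ∂(P N); let Rmom : ℕ → Fin 3 → ℝ := fun N j => Emom N t j - Emom N 0 j - ∫ s in (0 : ℝ)..t, Ekin N s j; let pc : ℝ → ℝ → ℝ := fun r ϑ => r * ϑ * (Literature.MathematicalPhysics.KineticTheory.hsCompressibility (r * σ ^ 3) - 1); let Cmom : ℕ → ℕ → Fin 3 → ℝ := fun N m j => ∫ s in (0 : ℝ)..t, ∑ k ∈ Fintype.piFinset (fun _ : Fin 3 => Finset.range m), pc ((m : ℝ) ^ 3 * mass N s m k) (temp N s m k) * gI m k j; let Een : ℕ → ℝ → ℝ := fun N s => ∫ z, Literature.MathematicalPhysics.KineticTheory.empiricalEnergyField ((Φ N).flow s z) χ ∂(P N); let Ekin3 : ℕ → ℝ → ℝ := fun N s => ∫ z, ((N : ℝ) + 1)⁻¹ * ∑ i : Fin (N + 1), w ((Φ N).flow s z i) * (‖((Φ N).flow s z i).2‖ ^ 2 / 2) ∂(P N); let Ren : ℕ → ℝ := fun N => Een N t - Een N 0 - ∫ s in (0 : ℝ)..t, Ekin3 N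 s; let Cen : ℕ → ℕ → ℝ := fun N m => ∫ s in (0 : ℝ)..t, ∑ k ∈ Fintype.piFinset (fun _ : Fin 3 => Finset.range m), pc ((m : ℝ) ^ 3 * mass N s m k) (temp N s m k) * ∑ j : Fin 3, vel N s m k j * gI m k j; let LG : ℝ → ℕ → Prop := fun δ m => ∀ᶠ N : ℕ in Filter.atTop, ∀ s ∈ Set.Icc 0 t, ∃ (ca cθ : (Fin 3 → ℕ) → ℝ) (cu : (Fin 3 → ℕ) → (EuclideanSpace ℝ (Fin 3))), (∀ k, 0 < ca k ∧ 0 < cθ k) ∧ InformationTheory.klDiv ((Φ N).lawAt (P N) s) (Literature.MathematicalPhysics.KineticTheory.localGibbsLaw σ (fun x => ca (idx m x)) (fun x => cu (idx m x)) (fun x => cθ (idx m x)) N (Φ N)) ≤ ENNReal.ofReal (δ * ((N : ℝ) + 1)); ∀ ε : ℝ, 0 < ε → ∃ δ : ℝ, 0 < δ ∧ ∃ m₀ : ℕ, ∀ m : ℕ, m₀ ≤ m → LG δ m → ∀ᶠ N : ℕ in Filter.atTop, (∀ j : Fin 3, |Rmom N j - Cmom N m j| ≤ ε) ∧ |Ren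 N - Cen N m| ≤ ε

/-- item stmt-AtomisticToContinuum-6999 · crux · rank 4 · closed · moot by None · by planner
why it might fail: Energy is conserved only globally: after ≍N^{1/3} collisions per unit time a vanishing fraction of spheres could carry O(1) energy in the |v|³ tail; OllaVaradhanYau1993 §1 removed exactly this obstacle by modifying the kinetic energy, impossible for true hard spheres.
sources: OllaVaradhanYau1993, Spohn1991, Cercignani1988
[crux] (card S3) under the conjunct's hypotheses, for t < T: ∀ δ>0 ∃ R, eventually in N, ∫₀ᵗ
E_{P_N}[(N+1)⁻¹ Σ_i |v_i(s)|³ 1{|v_i(s)| ≥ R}] ds ≤ δ (lintegral form, junk-free): time-integrated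
uniform integrability of the cubic velocity moment of the one-body intensity along the deterministic
evolution — the only moment beyond the conserved energy that the kinetic energy-flux closure needs.
Weaker than LargeVelocityControl (0781, exponential moments). [difficulty: L] -/
@[route_item "route-AtomisticToContinuum-OneBodyEntropySqueeze"]
def CubicMomentUI : Prop :=
  ∀ (a₀ θ₀ : (UnitAddTorus (Fin 3)) → ℝ) (u₀ : (UnitAddTorus (Fin 3)) → (EuclideanSpace ℝ (Fin 3))), Continuous a₀ → Continuous θ₀ → Continuous u₀ → (∀ x, 0 < a₀ x) → (∀ x, 0 < θ₀ x) → ∃ σ₀ : ℝ, 0 < σ₀ ∧ ∀ σ : ℝ, 0 < σ → σ < σ₀ → ∀ (T : ℝ) (ρ θ : ℝ → (UnitAddTorus (Fin 3)) → ℝ) (u : ℝ → (UnitAddTorus (Fin 3)) → (EuclideanSpace ℝ (Fin 3))), Literature.MathematicalPhysics.KineticTheory.IsHardSphereEulerSolution σ T ρ u θ → ∀ Φ : (N : ℕ) → Literature.Analysis.FluidPDE.HardSphereFlow (Literature.Analysis.FluidPDE.Torus.geometry (Fin 3)) (Literature.MathematicalPhysics.KineticTheory.hsDiameter σ N) (N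 + 1), Literature.MathematicalPhysics.KineticTheory.TendstoHydroFieldsAt (fun N => Literature.MathematicalPhysics.KineticTheory.localGibbsLaw σ a₀ u₀ θ₀ N (Φ N)) Φ ρ u θ 0 → ∀ t ∈ Set.Ico 0 T, ∀ δ : ℝ, 0 < δ → ∃ R : ℝ, ∀ᶠ N : ℕ in Filter.atTop, (∫⁻ s in Set.Ioo 0 t, ∫⁻ z, ENNReal.ofReal (((N : ℝ) + 1)⁻¹ * ∑ i : Fin (N + 1), (if R ≤ ‖((Φ N).flow s z i).2‖ then ‖((Φ N).flow s z i).2‖ ^ 3 else 0)) ∂(Literature.MathematicalPhysics.KineticTheory.localGibbsLaw σ a₀ u₀ θ₀ N (Φ N))) ≤ ENNReal.ofReal δ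

/-- item stmt-AtomisticToContinuum-3091 · crux · rank 5 · open · by planner
why it might fail: DenseExcursion (shock-free self-similar implosion tracked by the σ-family; route ImplosionLoophole) refutes it outright; even if true it is a σ-uniform density bound at the FIRST singularity of 3-D compressible Euler for all smooth data.
sources: Sideris1985, Majda1984, Spohn1991
[crux] (card crux 1B ∪ 3; the hidden PDE crux of every route) for every η > 0 and all continuous
positive profiles there is σ₀ > 0 such that for 0 < σ < σ₀, every classical hard-sphere-Euler
solution on [0,T) whose t = 0 fields are the LLN limit of the local Gibbs laws satisfies ρ_t(x)σ³ <
η for all t < T and x — i.e. limsup_{σ→0} σ³ sup_{t<T*_σ} ‖ρ_σ(t)‖_∞ = 0 profile by profile. For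
profiles whose ideal-gas development is global or breaks by a non-degenerate shock (Luk–Speck /
Buckmaster–Shkoller–Vicol open sets) this is stability of shock formation under an O(σ³)
equation-of-state and data perturbation; in general it is a σ-uniform density bound at the FIRST
singularity of 3-D compressible Euler for all smooth data. [deps: EosContinuity,
LocalGibbsDensityLimit] [difficulty: open-problem] -/
@[route_item "route-AtomisticToContinuum-OneBodyEntropySqueeze"]
def DiluteSelfConsistency : Prop :=
  ∀ η : ℝ, 0 < η → ∀ (a₀ θ₀ : Literature.MathematicalPhysics.KineticTheory.T3 → ℝ) (u₀ : Literature.MathematicalPhysics.KineticTheory.T3 → Literature.MathematicalPhysics.KineticTheory.V3), Continuous a₀ → Continuous θ₀ → Continuous u₀ → (∀ x, 0 < a₀ x) → (∀ x, 0 < θ₀ x) → ∃ σ₀ : ℝ, 0 < σ₀ ∧ ∀ σ : ℝ, 0 < σ → σ < σ₀ → ∀ (T : ℝ) (ρ θ : ℝ → Literature.MathematicalPhysics.KineticTheory.T3 → ℝ) (u : ℝ → Literature.MathematicalPhysics.KineticTheory.T3 → Literature.MathematicalPhysics.KineticTheory.V3), Literature.MathematicalPhysics.KineticTheory.IsHardSphereEulerSolution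 σ T ρ u θ → ∀ Φ : (N : ℕ) → Literature.Analysis.FluidPDE.HardSphereFlow (Literature.Analysis.FluidPDE.Torus.geometry (Fin 3)) (Literature.MathematicalPhysics.KineticTheory.hsDiameter σ N) (N + 1), Literature.MathematicalPhysics.KineticTheory.TendstoHydroFieldsAt (fun N => Literature.MathematicalPhysics.KineticTheory.localGibbsLaw σ a₀ u₀ θ₀ N (Φ N)) Φ ρ u θ 0 → ∀ t ∈ Set.Ico 0 T, ∀ x, ρ t x * σ ^ 3 < η

/-- item stmt-AtomisticToContinuum-0767 · support · rank 9 · closed · moot by None · by planner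
sources: Ruelle1969, LebowitzPenrose1964, Spohn1991
[support] Exponential law of large numbers for canonical local Gibbs states of N+1 hard spheres of
diameter σ(N+1)^{-1/3} on 𝕋³: for continuous a, θ₀ > 0, u₀, ∃ σ₀ ∀ σ<σ₀ ∃ continuous ρ₀ > 0
(equilibrium density profile at activity a) with the laws probability measures for all N and
P(|field − limit| > δ) ≤ C e^{-(N+1)/C} for the three fields, C = C(χ, δ) uniform in N and in the
flow. Low-density cluster expansion (Ruelle1969 Ch. 4, LebowitzPenrose1964) + Gaussian velocities.
Strengthens Literature fact localGibbs_lln. -/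
@[route_item "route-AtomisticToContinuum-OneBodyEntropySqueeze"]
def LocalGibbsConcentration : Prop :=
  ∀ (a θ₀ : Literature.MathematicalPhysics.KineticTheory.T3 → ℝ) (u₀ : Literature.MathematicalPhysics.KineticTheory.T3 → Literature.MathematicalPhysics.KineticTheory.V3), Continuous a → Continuous θ₀ → Continuous u₀ → (∀ x, 0 < a x) → (∀ x, 0 < θ₀ x) → ∃ σ₀ : ℝ, 0 < σ₀ ∧ ∀ σ : ℝ, 0 < σ → σ < σ₀ → ∃ ρ₀ : Literature.MathematicalPhysics.KineticTheory.T3 → ℝ, Continuous ρ₀ ∧ (∀ x, 0 < ρ₀ x) ∧ (∀ (N : ℕ) (Φ : Literature.Analysis.FluidPDE.HardSphereFlow (Literature.Analysis.FluidPDE.Torus.geometry (Fin 3)) (Literature.MathematicalPhysics.KineticTheory.hsDiameter σ N) (N + 1)), MeasureTheory.IsProbabilityMeasure (Literature.MathematicalPhysics.KineticTheory.localGibbsLaw σ a u₀ θ₀ N Φ)) ∧ ∀ χ : Literature.MathematicalPhysics.KineticTheory.T3 → ℝ, Continuous χ → ∀ δ : ℝ, 0 < δ → ∃ C : ℝ,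 0 < C ∧ ∀ (N : ℕ) (Φ : Literature.Analysis.FluidPDE.HardSphereFlow (Literature.Analysis.FluidPDE.Torus.geometry (Fin 3)) (Literature.MathematicalPhysics.KineticTheory.hsDiameter σ N) (N + 1)), Literature.MathematicalPhysics.KineticTheory.localGibbsLaw σ a u₀ θ₀ N Φ {z | δ < |Literature.MathematicalPhysics.KineticTheory.empiricalDensityField z χ - ∫ x, χ x * ρ₀ x|} ≤ ENNReal.ofReal (C * Real.exp (-(C⁻¹ * (N + 1)))) ∧ Literature.MathematicalPhysics.KineticTheory.localGibbsLaw σ a u₀ θ₀ N Φ {z | δ < ‖Literature.MathematicalPhysics.KineticTheory.empiricalMomentumField z χ - ∫ x, (χ x * ρ₀ x) • u₀ x‖} ≤ ENNReal.ofReal (C * Real.exp (-(C⁻¹ * (N + 1)))) ∧ Literature.MathematicalPhysics.KineticTheory.localGibbsLaw σ a u₀ θ₀ N Φ {z | δ < |Literature.MathematicalPhysics.KineticTheory.empiricalEnergyField z χ - ∫ x, χ x * Literature.MathematicalPhysics.KineticTheory.totalEnergyDensity (ρ₀ x) (u₀ x) (θ₀ x)|} ≤ ENNReal.ofReal (C *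 Real.exp (-(C⁻¹ * (N + 1))))

/-- item stmt-AtomisticToContinuum-0768 · support · rank 9 · open · by planner
sources: Ruelle1969, LebowitzPenrose1964
[support] Hard-sphere equation of state at low density: ∃ η₀ > 0 and F real-analytic on (−η₀, η₀)
with hsExcessFreeEnergy = F on [0, η₀), F(0) = 0, F'(0) = 2π/3 (second virial coefficient of
unit-diameter spheres), and the canonical thermodynamic limit −N⁻¹ log hsFreeVolume η N → F(η)
exists (not just limsup) for η ∈ [0, η₀). Ruelle1969 §3.4 (existence), LebowitzPenrose1964
(convergence of the virial expansion ⇒ analyticity). Makes hsCompressibility/hsPressure smooth and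
Z(η) = 1 + (2π/3)η + O(η²); needed by every route (hyperbolicity of the Euler system, virial
theorem). -/
@[route_item "route-AtomisticToContinuum-OneBodyEntropySqueeze"]
def HsEosLowDensity : Prop :=
  ∃ η₀ : ℝ, 0 < η₀ ∧ ∃ F : ℝ → ℝ, AnalyticOnNhd ℝ F (Set.Ioo (-η₀) η₀) ∧ Set.EqOn Literature.MathematicalPhysics.KineticTheory.hsExcessFreeEnergy F (Set.Ico 0 η₀) ∧ F 0 = 0 ∧ deriv F 0 = 2 * Real.pi / 3 ∧ ∀ η ∈ Set.Ico 0 η₀, Filter.Tendsto (fun N : ℕ => -(N : ℝ)⁻¹ * Real.log (Literature.MathematicalPhysics.KineticTheory.hsFreeVolume η N)) Filter.atTop (nhds (F η))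

/-- item stmt-AtomisticToContinuum-0769 · support · rank 9 · open · by planner
sources: Yau1991, KipnisLandim1999, OllaVaradhanYau1993
[assembly] X_RE → HydrodynamicLimit: entropy inequality μ(A) ≤ (log 2 + H(μ|λ))/log(1 + 1/λ(A))
(from Donsker–Varadhan / Mathlib klDiv API) with λ(A) ≤ C e^{-(N+1)/C} and H = o(N) gives μ(A) → 0;
μ = lawAt (Φ N) P t = P.map (flow t) turns μ{z | δ < |field z − ·|} into P{z | δ < |field (flow t z)
− ·|} (measurable_flow); the reference concentration is stated for z itself and TendstoHydroFieldsAt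
at time 0 of the reference law is not needed. Zero-mass case impossible by the IsProbabilityMeasure
clauses; take σ₀ from X_RE. -/
@[route_item "route-AtomisticToContinuum-OneBodyEntropySqueeze"]
def RelEntropyToLimit : Prop :=
  RelEntropyVanishing → Literature.MathematicalPhysics.KineticTheory.HydrodynamicLimit

/-- item stmt-AtomisticToContinuum-7000 · support · rank 9 · closed · moot by None · by planner
sources: Ruelle1969, LebowitzPenrose1964, JansenKunaTsagkarogiannis2023, HelmuthPerkinsPetti2022
[support] static LDA package for the canonical inhomogeneous dilute hard-sphere gas on 𝕋³ at fixed
reduced density (∃ η₁ > 0, ∀ σ > 0): (A) every measurable activity profile with Λ⁻¹ ≤ a ≤ Λ and Λ²σ³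
≤ η₁ is e^c · ρ · e^{g_σ(ρ)} for a normalised measurable density ρ ∈ [(2Λ²)⁻¹, 2Λ²], g_σ(r) =
f_ex(rσ³) + rσ³ f_ex′(rσ³) the excess chemical potential (f_ex = hsExcessFreeEnergy); (B) for every
normalised measurable density ρ ≥ c > 0 with packing ρσ³ ≤ η₁, activity a = ρ e^{g_σ(ρ)} and any
measurable velocity / positive temperature profiles: (N+1)⁻¹ log canonicalPartition → ∫ ρ · ρσ³
f_ex′(ρσ³) (= ∫ρ(Z − 1)), the local Gibbs laws are probability measures, and the MEAN empirical
density → ρ. Cluster expansion / inhomogeneous virial inversion; uniformity over compact block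
families follows from the exact 1-Lipschitz dependence of log Z on log a. Identifies the LLN density
that localGibbs_lln and LocalGibbsConcentration leave anonymous (card S2 + inverse EOS).
[difficulty: L] -/
@[route_item "route-AtomisticToContinuum-OneBodyEntropySqueeze"]
def HardSphereLDA : Prop :=
  ∃ η₁ : ℝ, 0 < η₁ ∧ ∀ σ : ℝ, 0 < σ → let g : ℝ → ℝ := fun r => Literature.MathematicalPhysics.KineticTheory.hsExcessFreeEnergy (r * σ ^ 3) + r * σ ^ 3 * deriv Literature.MathematicalPhysics.KineticTheory.hsExcessFreeEnergy (r * σ ^ 3); (∀ Λ : ℝ, 1 ≤ Λ → Λ ^ 2 * σ ^ 3 ≤ η₁ → ∀ a : (UnitAddTorus (Fin 3)) → ℝ, Measurable a → (∀ x, Λ⁻¹ ≤ a x ∧ a x ≤ Λ) → ∃ ρa : (UnitAddTorus (Fin 3)) → ℝ, Measurable ρa ∧ (∀ x, (2 * Λ ^ 2)⁻¹ ≤ ρa x ∧ ρa x ≤ 2 * Λ ^ 2) ∧ ∫ x, ρa x = 1 ∧ ∃ c : ℝ, ∀ x, a x = Real.exp c * ρa x * Real.exp (g (ρa x))) ∧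 (∀ c : ℝ, 0 < c → ∀ ρ₁ : (UnitAddTorus (Fin 3)) → ℝ, Measurable ρ₁ → (∀ x, c ≤ ρ₁ x ∧ ρ₁ x * σ ^ 3 ≤ η₁) → ∫ x, ρ₁ x = 1 → ∀ (u₁ : (UnitAddTorus (Fin 3)) → (EuclideanSpace ℝ (Fin 3))) (θ₁ : (UnitAddTorus (Fin 3)) → ℝ), Measurable u₁ → Measurable θ₁ → (∀ x, 0 < θ₁ x) → ∀ Φ : (N : ℕ) → Literature.Analysis.FluidPDE.HardSphereFlow (Literature.Analysis.FluidPDE.Torus.geometry (Fin 3)) (Literature.MathematicalPhysics.KineticTheory.hsDiameter σ N) (N + 1), let a₁ : (UnitAddTorus (Fin 3)) → ℝ := fun x => ρ₁ x * Real.exp (g (ρ₁ x)); Filter.Tendsto (fun N : ℕ => ((N : ℝ) + 1)⁻¹ * Real.log (Literature.Analysis.FluidPDE.canonicalPartition (Literature.Analysis.FluidPDE.Torus.geometry (Fin 3)) (Literature.MathematicalPhysics.KineticTheory.hsDiameter σ N) (N + 1) (Literature.MathematicalPhysics.KineticTheory.localGibbsProfile a₁ u₁ θ₁))) Filter.atTop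 (nhds (∫ x, ρ₁ x * (ρ₁ x * σ ^ 3 * deriv Literature.MathematicalPhysics.KineticTheory.hsExcessFreeEnergy (ρ₁ x * σ ^ 3)))) ∧ (∀ N, MeasureTheory.IsProbabilityMeasure (Literature.MathematicalPhysics.KineticTheory.localGibbsLaw σ a₁ u₁ θ₁ N (Φ N))) ∧ ∀ χ : (UnitAddTorus (Fin 3)) → ℝ, Continuous χ → Filter.Tendsto (fun N : ℕ => ∫ z, Literature.MathematicalPhysics.KineticTheory.empiricalDensityField z χ ∂(Literature.MathematicalPhysics.KineticTheory.localGibbsLaw σ a₁ u₁ θ₁ N (Φ N))) Filter.atTop (nhds (∫ x, χ x * ρ₁ x)))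

/-- item stmt-AtomisticToContinuum-7001 · support · rank 9 · closed · moot by None · by planner
sources: Dafermos1979, BrezinaFeireisl2018, GwiazdaSwierczewskagwiazdaWiedemann2015, BerthelinVasseur2005
[support] (card S5) Dafermos–DiPerna relative-entropy stability for the hard-sphere Euler system on
𝕋³ in A-PRIORI form, with ONLY the global entropy inequality: ∃ η₀ such that for a classical
solution U on [0,T) with packing < η₀, t < T, a compact K inside the positivity/low-packing region
and ε > 0 there is δ > 0 such that every measurable K-valued field V(s,x), s ≤ t, with (i) ∫
h_σ(V(s)) ≤ ∫ h_σ(U(0)) + δ for all s (h_σ = −ρ s_σ in conservative variables), (ii) ‖V(0) −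
U(0)‖²_{L²} ≤ δ, (iii) weak-form residual of the five conservation laws tested against the entropy
variables λ^E = Dh_σ(U) (explicit: (−s_σ + 5/2 − |u|²/2θ + ρσ³f_ex′, u/θ, −1/θ)) at most δ on [0,t],
satisfies ‖V(s) − U(s)‖²_{L²} ≤ ε for all s ≤ t. Proof: ℰ = ∫[h(V) − h(U) − λ^E·(V − U)],
entropy–flux compatibility (Gibbs relation θ ds = de + p d(1/ρ) holds for the hs EOS), Gronwall;
strict convexity of h_σ at packing < η₀ is HsEntropyConvex (0817). [difficulty: L] -/
@[route_item "route-AtomisticToContinuum-OneBodyEntropySqueeze"]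
def EntropicWeakStrongHS : Prop :=
  ∃ η₀ : ℝ, 0 < η₀ ∧ ∀ σ : ℝ, 0 < σ → ∀ (T : ℝ) (ρ θ : ℝ → (UnitAddTorus (Fin 3)) → ℝ) (u : ℝ → (UnitAddTorus (Fin 3)) → (EuclideanSpace ℝ (Fin 3))), Literature.MathematicalPhysics.KineticTheory.IsHardSphereEulerSolution σ T ρ u θ → (∀ s ∈ Set.Ico 0 T, ∀ x, ρ s x * σ ^ 3 < η₀) → ∀ t ∈ Set.Ico 0 T, ∀ K : Set (ℝ × (EuclideanSpace ℝ (Fin 3)) × ℝ), IsCompact K → K ⊆ {U : ℝ × (EuclideanSpace ℝ (Fin 3)) × ℝ | 0 < U.1 ∧ U.1 * σ ^ 3 < η₀ ∧ ‖U.2.1‖ ^ 2 < 2 * U.1 * U.2.2} → ∀ ε : ℝ, 0 < ε → ∃ δ : ℝ, 0 < δ ∧ ∀ V : ℝ → (UnitAddTorus (Fin 3)) → ℝ × (EuclideanSpace ℝ (Fin 3)) × ℝ, Measurable (Function.uncurry V) → (∀ s x, V s x ∈ K) → let θo : ℝ × (EuclideanSpace ℝ (Fin 3)) × ℝ → ℝ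 := fun U => 2 / 3 * (U.2.2 / U.1 - ‖U.2.1‖ ^ 2 / (2 * U.1 ^ 2)); let h : ℝ × (EuclideanSpace ℝ (Fin 3)) × ℝ → ℝ := fun U => -(U.1 * (3 / 2 * Real.log (θo U) - Real.log U.1 - Literature.MathematicalPhysics.KineticTheory.hsExcessFreeEnergy (U.1 * σ ^ 3))); let Ucl : ℝ → (UnitAddTorus (Fin 3)) → ℝ × (EuclideanSpace ℝ (Fin 3)) × ℝ := fun s x => (ρ s x, ρ s x • u s x, Literature.MathematicalPhysics.KineticTheory.totalEnergyDensity (ρ s x) (u s x) (θ s x)); let lam : ℝ → (UnitAddTorus (Fin 3)) → ℝ × (EuclideanSpace ℝ (Fin 3)) × ℝ := fun s x => (-(3 / 2 * Real.log (θ s x) - Real.log (ρ s x) - Literature.MathematicalPhysics.KineticTheory.hsExcessFreeEnergy (ρ s x * σ ^ 3)) + 5 / 2 - ‖u s x‖ ^ 2 / (2 * θ s x) + ρ s x * σ ^ 3 * deriv Literature.MathematicalPhysics.KineticTheory.hsExcessFreeEnergy (ρ s x * σ ^ 3), (θ s x)⁻¹ • u s x, -(θ s x)⁻¹); let flux : Fin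 3 → ℝ × (EuclideanSpace ℝ (Fin 3)) × ℝ → ℝ × (EuclideanSpace ℝ (Fin 3)) × ℝ := fun i U => (U.2.1 i, (U.2.1 i / U.1) • U.2.1 + Literature.MathematicalPhysics.KineticTheory.hsPressure σ U.1 (θo U) • EuclideanSpace.single i (1 : ℝ), (U.2.2 + Literature.MathematicalPhysics.KineticTheory.hsPressure σ U.1 (θo U)) * U.2.1 i / U.1); let pair : (ℝ × (EuclideanSpace ℝ (Fin 3)) × ℝ) → (ℝ × (EuclideanSpace ℝ (Fin 3)) × ℝ) → ℝ := fun L U => L.1 * U.1 + (∑ j : Fin 3, L.2.1 j * U.2.1 j) + L.2.2 * U.2.2; let W : ℝ → ℝ := fun s => (∫ x, pair (lam s x) (V s x)) - (∫ x, pair (lam 0 x) (V 0 x)) - ∫ τ in (0 : ℝ)..s, ∫ x, (pair (Literature.Analysis.FunctionSpaces.Torus.timeDerivWithin (Set.Ico 0 T) lam τ x) (V τ x) + ∑ i : Fin 3, pair (Literature.Analysis.FunctionSpaces.Torus.partialDeriv i (lam τ) x) (flux i (V τ x))); let dist2 : ℝ → ℝ := fun s => ∫ x, ((V s x).1 - (Ucl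 s x).1) ^ 2 + ‖(V s x).2.1 - (Ucl s x).2.1‖ ^ 2 + ((V s x).2.2 - (Ucl s x).2.2) ^ 2; (∀ s ∈ Set.Icc 0 t, ∫ x, h (V s x) ≤ (∫ x, h (Ucl 0 x)) + δ) → dist2 0 ≤ δ → (∀ s ∈ Set.Icc 0 t, |W s| ≤ δ) → ∀ s ∈ Set.Icc 0 t, dist2 s ≤ ε

/-- item stmt-AtomisticToContinuum-7002 · support · rank 9 · closed · moot by None · by planner
sources: Spohn1991, OllaVaradhanYau1993
[support] a-priori non-degeneracy of the block mean profile (needed to place the block-matched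
conjugate parameters in a compact set): under the conjunct's hypotheses and t < T, ∃ m₀ ∀ m ≥ m₀,
eventually in N, for all s ≤ t and all cubes B: m³m_B ∈ [½ inf ρ, 2 sup ρ], θ_B ∈ [½ inf θ, 2 sup
θ], |u_B| ≤ 1 + sup|u| (inf/sup of the classical solution over [0,t] × 𝕋³; m₀ absorbs in-block
velocity variance, which counts as heat). Implied by the conjunct; an input of the same a-priori
nature as K1, not separately staffed. [difficulty: open-problem] -/
@[route_item "route-AtomisticToContinuum-OneBodyEntropySqueeze"]
def MeanBlocksInRange : Prop :=
  ∀ (a₀ θ₀ : (UnitAddTorus (Fin 3)) → ℝ) (u₀ : (UnitAddTorus (Fin 3)) → (EuclideanSpace ℝ (Fin 3))), Continuous a₀ → Continuous θ₀ → Continuous u₀ → (∀ x, 0 < a₀ x) → (∀ x, 0 < θ₀ x) → ∃ σ₀ : ℝ, 0 < σ₀ ∧ ∀ σ : ℝ, 0 < σ → σ < σ₀ → ∀ (T : ℝ) (ρ θ : ℝ → (UnitAddTorus (Fin 3)) → ℝ) (u : ℝ → (UnitAddTorus (Fin 3)) → (EuclideanSpace ℝ (Fin 3))), Literature.MathematicalPhysics.KineticTheory.IsHardSphereEulerSolution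 σ T ρ u θ → ∀ Φ : (N : ℕ) → Literature.Analysis.FluidPDE.HardSphereFlow (Literature.Analysis.FluidPDE.Torus.geometry (Fin 3)) (Literature.MathematicalPhysics.KineticTheory.hsDiameter σ N) (N + 1), Literature.MathematicalPhysics.KineticTheory.TendstoHydroFieldsAt (fun N => Literature.MathematicalPhysics.KineticTheory.localGibbsLaw σ a₀ u₀ θ₀ N (Φ N)) Φ ρ u θ 0 → ∀ t ∈ Set.Ico 0 T, let P : (N : ℕ) → MeasureTheory.Measure (Literature.Analysis.FluidPDE.Config (N + 1) (Fin 3) (UnitAddTorus (Fin 3))) := fun N => Literature.MathematicalPhysics.KineticTheory.localGibbsLaw σ a₀ u₀ θ₀ N (Φ N); let μ : (N : ℕ) → ℝ → MeasureTheory.Measure ((UnitAddTorus (Fin 3)) × (EuclideanSpace ℝ (Fin 3))) := fun N s => ((N : ENNReal) + 1)⁻¹ • MeasureTheory.Measure.sum (fun i : Fin (N + 1) => ((Φ N).lawAt (P N) s).map (fun z => z i)); let idx : ℕ → (UnitAddTorus (Fin 3)) → (Fin 3 → ℕ) := fun m x i => ⌊(m : ℝ) * Literature.Analysis.FunctionSpaces.Torus.repr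 x i⌋₊; let μB : ℕ → ℝ → ℕ → (Fin 3 → ℕ) → MeasureTheory.Measure (EuclideanSpace ℝ (Fin 3)) := fun N s m k => ((μ N s).restrict ({x : (UnitAddTorus (Fin 3)) | idx m x = k} ×ˢ (Set.univ : Set (EuclideanSpace ℝ (Fin 3))))).snd; let mass : ℕ → ℝ → ℕ → (Fin 3 → ℕ) → ℝ := fun N s m k => ((μB N s m k) Set.univ).toReal; let vel : ℕ → ℝ → ℕ → (Fin 3 → ℕ) → (EuclideanSpace ℝ (Fin 3)) := fun N s m k => (mass N s m k)⁻¹ • ∫ v, v ∂(μB N s m k); let temp : ℕ → ℝ → ℕ → (Fin 3 → ℕ) → ℝ := fun N s m k => (3 * mass N s m k)⁻¹ * ∫ v, ‖v - vel N s m k‖ ^ 2 ∂(μB N s m k); ∃ m₀ : ℕ, ∀ m : ℕ, m₀ ≤ m → ∀ᶠ N : ℕ in Filter.atTop, ∀ s ∈ Set.Icc 0 t, ∀ k ∈ Fintype.piFinset (fun _ : Fin 3 => Finset.range m), (⨅ q : Set.Icc 0 t × (UnitAddTorus (Fin 3)), ρ q.1 q.2) / 2 ≤ (m : ℝ) ^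 3 * mass N s m k ∧ (m : ℝ) ^ 3 * mass N s m k ≤ 2 * ⨆ q : Set.Icc 0 t × (UnitAddTorus (Fin 3)), ρ q.1 q.2 ∧ (⨅ q : Set.Icc 0 t × (UnitAddTorus (Fin 3)), θ q.1 q.2) / 2 ≤ temp N s m k ∧ temp N s m k ≤ 2 * ⨆ q : Set.Icc 0 t × (UnitAddTorus (Fin 3)), θ q.1 q.2 ∧ ‖vel N s m k‖ ≤ 1 + ⨆ q : Set.Icc 0 t × (UnitAddTorus (Fin 3)), ‖u q.1 q.2‖

/-- item stmt-AtomisticToContinuum-7003 · support · rank 9 · closed · moot by None · by planner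
sources: Csiszar1975, SaintRaymond2009, Jaynes1965
[support] (card S6, exact, provable now) the one-body shadow of relative entropy: for any N, flow,
time t, block scale m and ANY block-constant local Gibbs reference ψ (positive block temperatures),
(N+1) · Σ_B klDiv( block-B velocity law of the one-body intensity measure of lawAt Φ P₀ t ‖ m_B ·
Maxwellian(u^ψ_B, θ^ψ_B) ) ≤ klDiv(lawAt Φ P₀ t ‖ ψ). Chain rule (condition on positions; velocities
under ψ are a PRODUCT of Maxwellians), superadditivity of KL for product references, joint convexity
for the average over particles, data processing to the velocity marginal; by the Gaussian Pythagoras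
the moment-matched Maxwellian does even better. With the bookkeeping identity this is the card's
squeeze (SQ1): one-body non-Maxwellianity D^m_N(t) ≤ 𝒮^m_N(t) − 𝒮[U₀] + o(1). [difficulty:
provable-now] -/
@[route_item "route-AtomisticToContinuum-OneBodyEntropySqueeze"]
def OneBodyShadow : Prop :=
  ∀ (σ : ℝ) (a₀ θ₀ : (UnitAddTorus (Fin 3)) → ℝ) (u₀ : (UnitAddTorus (Fin 3)) → (EuclideanSpace ℝ (Fin 3))) (N : ℕ) (Φ : Literature.Analysis.FluidPDE.HardSphereFlow (Literature.Analysis.FluidPDE.Torus.geometry (Fin 3)) (Literature.MathematicalPhysics.KineticTheory.hsDiameter σ N) (N + 1)) (t : ℝ) (m : ℕ) (ca cθ : (Fin 3 → ℕ) → ℝ) (cu : (Fin 3 → ℕ) → (EuclideanSpace ℝ (Fin 3))), (∀ k, 0 < cθ k) → let idx : (UnitAddTorus (Fin 3)) → (Fin 3 → ℕ) := fun x i => ⌊(m : ℝ) * Literature.Analysis.FunctionSpaces.Torus.repr x i⌋₊; let P₀ : MeasureTheory.Measure (Literature.Analysis.FluidPDE.Config (N + 1) (Fin 3) (UnitAddTorus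 (Fin 3))) := Literature.MathematicalPhysics.KineticTheory.localGibbsLaw σ a₀ u₀ θ₀ N Φ; let ψ : MeasureTheory.Measure (Literature.Analysis.FluidPDE.Config (N + 1) (Fin 3) (UnitAddTorus (Fin 3))) := Literature.MathematicalPhysics.KineticTheory.localGibbsLaw σ (fun x => ca (idx x)) (fun x => cu (idx x)) (fun x => cθ (idx x)) N Φ; MeasureTheory.IsProbabilityMeasure P₀ → MeasureTheory.IsProbabilityMeasure ψ → let μ1 : MeasureTheory.Measure ((UnitAddTorus (Fin 3)) × (EuclideanSpace ℝ (Fin 3))) := ((N : ENNReal) + 1)⁻¹ • MeasureTheory.Measure.sum (fun i : Fin (N + 1) => (Φ.lawAt P₀ t).map (fun z => z i)); let μB : (Fin 3 → ℕ) → MeasureTheory.Measure (EuclideanSpace ℝ (Fin 3)) := fun k => (μ1.restrict ({x : (UnitAddTorus (Fin 3)) | idx x = k} ×ˢ (Set.univ : Set (EuclideanSpace ℝ (Fin 3))))).snd; ((N : ENNReal) + 1) * ∑ k ∈ Fintype.piFinset (fun _ : Fin 3 => Finset.range m), InformationTheory.klDiv (μB k) (MeasureTheory.volume.withDensity (fun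 v => ENNReal.ofReal (Literature.Analysis.FluidPDE.localMaxwellian ((μB k) Set.univ).toReal (cθ k) (cu k) v))) ≤ InformationTheory.klDiv (Φ.lawAt P₀ t) ψ

/-- item stmt-AtomisticToContinuum-7004 · support · rank 9 · closed · moot by None · by planner
sources: BerthelinVasseur2005, Dafermos1979, Spohn1991
[support] (card S1 verbatim: the isentropic special case of NoMeanEntropyProduction in
barotropic-energy form) if the Euler data are isentropic, s_σ(ρ₀(x), θ₀(x)) ≡ s⋆, then for t < T: ∀
δ>0 ∃ m₀ ∀ m ≥ m₀, eventually in N, for all s ≤ t: Δ^m_N(s) := Σ_B m_B (3/2 θ_B − 3/2 θ_ad(m³m_B)) /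
θ_ad(m³m_B) ≤ δ, θ_ad(r) = exp(2/3 (s⋆ + log r + f_ex(rσ³))) the data adiabat: no excess heat above
the adiabat = (θ_ad-weighted) no anomalous dissipation of the barotropic energy ∫ρ|u|²/2 + ∫ρ
e_ad(ρ) of the mean block fields. By concavity of log, Δ^m_N(s) bounds 𝒮^m_N(s) − s⋆ from above, so
this implies K1 for isentropic data; it is linear in the block energies (MD-friendly). [difficulty:
open-problem] -/
@[route_item "route-AtomisticToContinuum-OneBodyEntropySqueeze"]
def NoExcessHeatIsentropic : Prop :=
  ∀ (a₀ θ₀ : (UnitAddTorus (Fin 3)) → ℝ) (u₀ : (UnitAddTorus (Fin 3)) → (EuclideanSpace ℝ (Fin 3))), Continuous a₀ → Continuous θ₀ → Continuous u₀ → (∀ x, 0 < a₀ x) → (∀ x, 0 < θ₀ x) → ∃ σ₀ : ℝ, 0 < σ₀ ∧ ∀ σ : ℝ, 0 < σ → σ < σ₀ → ∀ (T : ℝ) (ρ θ : ℝ → (UnitAddTorus (Fin 3)) → ℝ) (u : ℝ → (UnitAddTorus (Fin 3)) → (EuclideanSpace ℝ (Fin 3))), Literature.MathematicalPhysics.KineticTheory.IsHardSphereEulerSolution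 σ T ρ u θ → ∀ sstar : ℝ, (∀ x, 3 / 2 * Real.log (θ 0 x) - Real.log (ρ 0 x) - Literature.MathematicalPhysics.KineticTheory.hsExcessFreeEnergy (ρ 0 x * σ ^ 3) = sstar) → ∀ Φ : (N : ℕ) → Literature.Analysis.FluidPDE.HardSphereFlow (Literature.Analysis.FluidPDE.Torus.geometry (Fin 3)) (Literature.MathematicalPhysics.KineticTheory.hsDiameter σ N) (N + 1), Literature.MathematicalPhysics.KineticTheory.TendstoHydroFieldsAt (fun N => Literature.MathematicalPhysics.KineticTheory.localGibbsLaw σ a₀ u₀ θ₀ N (Φ N)) Φ ρ u θ 0 → ∀ t ∈ Set.Ico 0 T, let P : (N : ℕ) → MeasureTheory.Measure (Literature.Analysis.FluidPDE.Config (N + 1) (Fin 3) (UnitAddTorus (Fin 3))) := fun N => Literature.MathematicalPhysics.KineticTheory.localGibbsLaw σ a₀ u₀ θ₀ N (Φ N); let μ : (N : ℕ) → ℝ → MeasureTheory.Measure ((UnitAddTorus (Fin 3)) × (EuclideanSpace ℝ (Fin 3))) := fun N s => ((N : ENNReal) + 1)⁻¹ • MeasureTheory.Measure.sum (fun i : Fin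 (N + 1) => ((Φ N).lawAt (P N) s).map (fun z => z i)); let idx : ℕ → (UnitAddTorus (Fin 3)) → (Fin 3 → ℕ) := fun m x i => ⌊(m : ℝ) * Literature.Analysis.FunctionSpaces.Torus.repr x i⌋₊; let μB : ℕ → ℝ → ℕ → (Fin 3 → ℕ) → MeasureTheory.Measure (EuclideanSpace ℝ (Fin 3)) := fun N s m k => ((μ N s).restrict ({x : (UnitAddTorus (Fin 3)) | idx m x = k} ×ˢ (Set.univ : Set (EuclideanSpace ℝ (Fin 3))))).snd; let mass : ℕ → ℝ → ℕ → (Fin 3 → ℕ) → ℝ := fun N s m k => ((μB N s m k) Set.univ).toReal; let vel : ℕ → ℝ → ℕ → (Fin 3 → ℕ) → (EuclideanSpace ℝ (Fin 3)) := fun N s m k => (mass N s m k)⁻¹ • ∫ v, v ∂(μB N s m k); let temp : ℕ → ℝ → ℕ → (Fin 3 → ℕ) → ℝ := fun N s m k => (3 * mass N s m k)⁻¹ * ∫ v, ‖v - vel N s m k‖ ^ 2 ∂(μB N s m k); let θad : ℝ → ℝ := fun r => Real.exp (2 / 3 * (sstar + Real.log r + Literature.MathematicalPhysics.KineticTheory.hsExcessFreeEnergy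 (r * σ ^ 3))); ∀ δ : ℝ, 0 < δ → ∃ m₀ : ℕ, ∀ m : ℕ, m₀ ≤ m → ∀ᶠ N : ℕ in Filter.atTop, ∀ s ∈ Set.Icc 0 t, (∑ k ∈ Fintype.piFinset (fun _ : Fin 3 => Finset.range m), mass N s m k * (3 / 2 * temp N s m k - 3 / 2 * θad ((m : ℝ) ^ 3 * mass N s m k)) / θad ((m : ℝ) ^ 3 * mass N s m k)) ≤ δ

/-- item stmt-AtomisticToContinuum-7005 · assembly · rank 1 · closed · moot by None · by planner
sources: Yau1991, Dafermos1979, Csiszar1975, Spohn1991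
[assembly] NoMeanEntropyProduction → CollisionalFluxLocality → CubicMomentUI → HardSphereLDA →
EntropicWeakStrongHS → MeanBlocksInRange → OneBodyShadow → HsEosLowDensity → LocalGibbsConcentration
→ DiluteSelfConsistency → RelEntropyToLimit → HydrodynamicLimit (steps (a)–(f) above; the typed
waypoint RelEntropyVanishing is produced inside). -/
@[route_item "route-AtomisticToContinuum-OneBodyEntropySqueeze"]
def Assembly : Prop :=
  NoMeanEntropyProduction → CollisionalFluxLocality → CubicMomentUI → HardSphereLDA → EntropicWeakStrongHS → MeanBlocksInRange → OneBodyShadow → HsEosLowDensity → LocalGibbsConcentration → DiluteSelfConsistency → RelEntropyToLimit → Literature.MathematicalPhysics.KineticTheory.HydrodynamicLimit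

end Summit.AtomisticToContinuum.HydrodynamicLimit.Theses.OneBodyEntropySqueeze
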